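import Summits.RiemannHypothesis.RiemannHypothesis.Theorems.UniversalFactorH0Decay
import Literature.NumberTheory.LFunctions.DeBruijnHDiv

/-!
# RiemannHypothesis / UniversalFactor — the ODE on the real axis and the exceptional wide directions

Route `RiemannHypothesis/UniversalFactor`, wide window `0 < a < π/8` of the target `LaplaceLoophole`
(stmt-2575; items `WideKernelTail` stmt-2581 and `ExceptionalWideNoGo` stmt-2583). With
`F = F_a = deBruijnHDiv (1 + u²/a²)` (real entire, even, `F − F''/a² = H_0` —
`deBruijnHDiv_laplace_sub_deriv_deriv`) the behaviour of `F(x)` as `x → +∞` is governed by an ODE on the real axis, which we treat by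
"variation of constants" (no Fubini, no convolution): for `c = ±a` the function `g_c = F' + cF` satisfies
`(g_c e^{−cx})' = (F'' − c²F) e^{−cx} = −a² H_0 e^{−cx}`, hence

  `g_c(x) e^{−cx} = g_c(0) − a² ∫₀ˣ H_0(t) e^{−ct} dt`            (`laplaceG_eq`).

* `c = a` (`laplaceG_pos_eq`): `F`, `F'` are bounded on `ℝ` (`exists_bound_deBruijnHDiv_laplace`),
  so `g_a e^{−ax} → 0`, which forces `aF(0) = g_a(0) = a² ∫₀^∞ H_0 e^{−at}` and
  `g_a(x) = a² e^{ax} ∫ₓ^∞ H_0 e^{−at} = O(e^{−bx})`;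
* `c = −a`: `g_{−a}(x) e^{ax} = −aF(0) − a² ∫₀^∞ H_0 e^{at} + a² ∫ₓ^∞ H_0 e^{at}` (the integrals
  converge by the decay `‖H_0(t)‖ ≤ C_b e^{−b|t|}`, `a < b < π/8`, of `UniversalFactorH0Decay.lean`),
  and `−aF(0) − a² ∫₀^∞ H_0 e^{at} = −2a · a∫₀^∞ H_0 cosh(a·)`;
* `2a e^{ax} F = e^{ax} g_a − e^{ax} g_{−a}`.

With a non-zero residue `∫₀^∞ H_0 cosh(a·)` these identities give the tail
`e^{ax}F_a(x) → a∫₀^∞ H_0 cosh(a·)` (already in the tree: `Theorems.wideKernelTail`, proved there by the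
convolution; not repeated here). With a VANISHING residue they give the main result of this file,
`UniversalFactor.norm_deBruijnHDiv_laplace_le_of_integral_cosh_eq_zero`: **in the exceptional wide
directions `F_a(x) = O(e^{−bx})` for every `b < π/8`** — the decay claimed in item
`ExceptionalWideNoGo` (stmt-RiemannHypothesis-2583).

References: N. G. de Bruijn, Duke Math. J. 17 (1950) (the transforms); E. C. Titchmarsh, *The theory
of the Riemann zeta-function* (1986), §10.1 (decay of `Ξ`); the route thesis (item WideKernelTail).
-/

noncomputable section

namespace Summit.RiemannHypothesis.RiemannHypothesis.Theorems

open MeasureTheory Set Filter Topology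
open Literature.NumberTheory.LFunctions
open Summit.RiemannHypothesis.RiemannHypothesis.Theses

/-! ## `F_a` and `F_a'` are bounded on the real axis -/

/-- **Uniform bounds on the real axis**: `‖F_a(x)‖, ‖F_a'(x)‖ ≤ B` for all real `x` (the kernel
`Φ/(1 + u²/a²)` and its first moment are integrable and `|cos(xu)|, |sin(xu)| ≤ 1`). [folklore] -/
theorem UniversalFactor.exists_bound_deBruijnHDiv_laplace (a : ℝ) :
    ∃ B : ℝ, ∀ x : ℝ, ‖deBruijnHDiv (fun u : ℝ => 1 + u ^ 2 / a ^ 2) x‖ ≤ B ∧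
      ‖deriv (deBruijnHDiv fun u : ℝ => 1 + u ^ 2 / a ^ 2) x‖ ≤ B := by
  set m : ℝ → ℝ := fun u ↦ 1 + u ^ 2 / a ^ 2 with hm
  have hadm : IsDivAdmissible m := isDivAdmissible_laplace a
  obtain ⟨C, T, hC, hb⟩ := hadm.exists_bound
  set B₀ : ℝ := ∫ u in Ioi (0 : ℝ), C * deBruijnHBound T (0 + ((0 : ℕ) : ℝ)) u with hB₀
  set B₁ : ℝ := ∫ u in Ioi (0 : ℝ), C * deBruijnHBound T (0 + ((1 : ℕ) : ℝ)) u with hB₁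
  have hB₀0 : 0 ≤ B₀ :=
    setIntegral_nonneg measurableSet_Ioi fun u _ ↦ mul_nonneg hC (deBruijnHBound_nonneg _ _ _)
  have hB₁0 : 0 ≤ B₁ :=
    setIntegral_nonneg measurableSet_Ioi fun u _ ↦ mul_nonneg hC (deBruijnHBound_nonneg _ _ _)
  refine ⟨B₀ + B₁, fun x ↦ ⟨?_, ?_⟩⟩
  · have hx : |((x : ℂ)).im| ≤ 0 := by simp
    have h1 : ‖deBruijnHDiv m x‖ ≤ B₀ := by
      rw [← divCosMoment_zero, divCosMoment]
      exact norm_integral_le_of_norm_le ((integrableOn_deBruijnHBound T _).const_mul C)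
        (ae_restrict_of_forall_mem measurableSet_Ioi fun u hu ↦ norm_divCosIntegrand_le hb 0 hx hu)
    linarith
  · have hx : |((x : ℂ)).im| ≤ 0 := by simp
    have h1 : ‖deriv (deBruijnHDiv m) x‖ ≤ B₁ := by
      rw [hadm.deriv_deBruijnHDiv, norm_neg, divSinMoment]
      exact norm_integral_le_of_norm_le ((integrableOn_deBruijnHBound T _).const_mul C)
        (ae_restrict_of_forall_mem measurableSet_Ioi fun u hu ↦ norm_divSinIntegrand_le hb 1 hx hu)
    linarith

/-! ## The ODE on the real axis: `(g_c e^{−cx})' = −a² H_0 e^{−cx}` for `c = ±a` -/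

/-- **Variation of constants.** For `a ≠ 0`, `c² = a²` and `F = F_a`: the function
`x ↦ (F'(x) + c F(x)) e^{−cx}` has derivative `−a² H_0(x) e^{−cx}` on `ℝ`
(`(F'' + cF') e^{−cx} − c (F' + cF) e^{−cx} = (F'' − a²F) e^{−cx}` and `F'' = a²(F − H_0)`).
[folklore] -/
theorem UniversalFactor.hasDerivAt_laplaceG {a c : ℝ} (ha : a ≠ 0) (hc : c ^ 2 = a ^ 2) (x : ℝ) :
    HasDerivAt (fun y : ℝ ↦ (deriv (deBruijnHDiv fun u : ℝ => 1 + u ^ 2 / a ^ 2) y +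
        (c : ℂ) * deBruijnHDiv (fun u : ℝ => 1 + u ^ 2 / a ^ 2) y) * (Real.exp (-(c * y)) : ℂ))
      (-(a : ℂ) ^ 2 * (deBruijnH 0 x * (Real.exp (-(c * x)) : ℂ))) x := by
  set F : ℂ → ℂ := deBruijnHDiv fun u : ℝ => 1 + u ^ 2 / a ^ 2 with hFdef
  have hFd : Differentiable ℂ F := differentiable_deBruijnHDiv_laplace a
  have hFd' : Differentiable ℂ (deriv F) := hFd.deriv
  have hφ : HasDerivAt (fun y : ℝ ↦ F y) (deriv F x) x := ((hFd x).hasDerivAt).comp_ofReal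
  have hφ' : HasDerivAt (fun y : ℝ ↦ deriv F y) (deriv (deriv F) x) x :=
    ((hFd' x).hasDerivAt).comp_ofReal
  have hODE : deriv (deriv F) x = (a : ℂ) ^ 2 * (F x - deBruijnH 0 x) := by
    have h : F x - deriv (deriv F) x / (a : ℂ) ^ 2 = deBruijnH 0 x :=
      deBruijnHDiv_laplace_sub_deriv_deriv a x
    have haC : (a : ℂ) ≠ 0 := by exact_mod_cast ha
    field_simp at h
    linear_combination -h
  have he : HasDerivAt (fun y : ℝ ↦ Real.exp (-(c * y))) (-c * Real.exp (-(c * x))) x := by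
    have h1 : HasDerivAt (fun y : ℝ ↦ -(c * y)) (-c) x :=
      (((hasDerivAt_id x).const_mul c).neg).congr_deriv (by simp)
    exact h1.exp.congr_deriv (by ring)
  have hg : HasDerivAt (fun y : ℝ ↦ deriv F y + (c : ℂ) * F y) (deriv (deriv F) x + (c : ℂ) * deriv F x) x :=
    hφ'.add (hφ.const_mul (c : ℂ))
  have hprod := hg.mul he.ofReal_comp
  refine hprod.congr_deriv ?_
  have hc' : (c : ℂ) ^ 2 = (a : ℂ) ^ 2 := by exact_mod_cast hc
  rw [hODE, Complex.ofReal_mul, Complex.ofReal_neg]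
  linear_combination (-(F ↑x) * ↑(Real.exp (-(c * x)))) * hc'

/-- **Integrated form**: for `a ≠ 0`, `c² = a²`, all real `x`,
`(F'(x) + cF(x)) e^{−cx} = (F'(0) + cF(0)) − a² ∫₀ˣ H_0(t) e^{−ct} dt` (fundamental theorem of
calculus for `hasDerivAt_laplaceG`; the integrand is continuous). [folklore] -/
theorem UniversalFactor.laplaceG_eq {a c : ℝ} (ha : a ≠ 0) (hc : c ^ 2 = a ^ 2) (x : ℝ) :
    (deriv (deBruijnHDiv fun u : ℝ => 1 + u ^ 2 / a ^ 2) x +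
        (c : ℂ) * deBruijnHDiv (fun u : ℝ => 1 + u ^ 2 / a ^ 2) x) * (Real.exp (-(c * x)) : ℂ) =
      (deriv (deBruijnHDiv fun u : ℝ => 1 + u ^ 2 / a ^ 2) (0 : ℝ) +
        (c : ℂ) * deBruijnHDiv (fun u : ℝ => 1 + u ^ 2 / a ^ 2) (0 : ℝ)) -
      (a : ℂ) ^ 2 * ∫ t in (0 : ℝ)..x, deBruijnH 0 t * (Real.exp (-(c * t)) : ℂ) := by
  have hcont : Continuous fun t : ℝ ↦ -(a : ℂ) ^ 2 * (deBruijnH 0 t * (Real.exp (-(c * t)) : ℂ)) := by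
    have h1 : Continuous fun t : ℝ ↦ deBruijnH 0 t :=
      (differentiable_deBruijnH_holds 0).continuous.comp Complex.continuous_ofReal
    have h2 : Continuous fun t : ℝ ↦ (Real.exp (-(c * t)) : ℂ) :=
      Complex.continuous_ofReal.comp (by fun_prop)
    exact continuous_const.mul (h1.mul h2)
  have h := intervalIntegral.integral_eq_sub_of_hasDerivAt
    (fun t _ ↦ UniversalFactor.hasDerivAt_laplaceG ha hc t) (hcont.intervalIntegrable 0 x)
  rw [intervalIntegral.integral_const_mul] at h
  simp only [mul_zero, neg_zero, Real.exp_zero, Complex.ofReal_one, mul_one, Complex.ofReal_zero] at h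
  linear_combination -h

/-! ## Integrability of `H_0 e^{±at}` on `(0, ∞)` for `|a| < π/8` -/

/-- For `|c| < π/8`, `t ↦ H_0(t) e^{−ct}` is integrable on `(0, ∞)` and
`‖H_0(t) e^{−ct}‖ ≤ C e^{−(b + c)t}` there, where `‖H_0(t)‖ ≤ C e^{−b|t|}` with `|c| < b < π/8`.
[folklore] -/
theorem UniversalFactor.integrableOn_deBruijnH_zero_mul_exp {b c C : ℝ} (hbc : -b < c)
    (hC : ∀ t : ℝ, ‖deBruijnH 0 t‖ ≤ C * Real.exp (-(b * |t|))) :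
    IntegrableOn (fun t : ℝ ↦ deBruijnH 0 t * (Real.exp (-(c * t)) : ℂ)) (Ioi 0) ∧
      ∀ t : ℝ, 0 < t → ‖deBruijnH 0 t * (Real.exp (-(c * t)) : ℂ)‖ ≤ C * Real.exp (-(b + c) * t) := by
  have hbound : ∀ t : ℝ, 0 < t →
      ‖deBruijnH 0 t * (Real.exp (-(c * t)) : ℂ)‖ ≤ C * Real.exp (-(b + c) * t) := by
    intro t ht
    rw [norm_mul, Complex.norm_real, Real.norm_eq_abs, abs_of_pos (Real.exp_pos _)]
    calc ‖deBruijnH 0 t‖ * Real.exp (-(c * t)) ≤ C * Real.exp (-(b * |t|)) * Real.exp (-(c * t)) :=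
          mul_le_mul_of_nonneg_right (hC t) (Real.exp_pos _).le
      _ = C * Real.exp (-(b + c) * t) := by
          rw [abs_of_pos ht, mul_assoc, ← Real.exp_add]; congr 1; congr 1; ring
  refine ⟨?_, hbound⟩
  have hcont : Continuous fun t : ℝ ↦ deBruijnH 0 t * (Real.exp (-(c * t)) : ℂ) :=
    ((differentiable_deBruijnH_holds 0).continuous.comp Complex.continuous_ofReal).mul
      (Complex.continuous_ofReal.comp (by fun_prop))
  refine Integrable.mono' ((integrableOn_exp_mul_Ioi (by linarith : -(b + c) < 0) 0).const_mul C)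
    hcont.aestronglyMeasurable (ae_restrict_of_forall_mem measurableSet_Ioi fun t ht ↦ hbound t ht)

/-! ## The growing mode is absent: `g_a(x) e^{−ax} = a² ∫ₓ^∞ H_0 e^{−at}` -/

/-- **No growing mode** (`c = a`, every `a > 0`): `a F_a(0) = a² ∫₀^∞ H_0(t) e^{−at} dt` and, for
`x ≥ 0`, `(F_a'(x) + a F_a(x)) e^{−ax} = a² ∫ₓ^∞ H_0(t) e^{−at} dt`. Indeed `g_a e^{−ax}` tends to
`L = g_a(0) − a² ∫₀^∞ H_0 e^{−at}` by `laplaceG_eq`, and `L ≠ 0` would make `‖g_a(x)‖ ≍ e^{ax}`,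
contradicting the boundedness of `F_a, F_a'` on `ℝ`; `F_a'(0) = 0` by evenness. [folklore] -/
theorem UniversalFactor.laplaceG_pos_eq {a : ℝ} (ha : 0 < a) :
    (a : ℂ) * deBruijnHDiv (fun u : ℝ => 1 + u ^ 2 / a ^ 2) (0 : ℝ) =
        (a : ℂ) ^ 2 * ∫ t in Ioi (0 : ℝ), deBruijnH 0 t * (Real.exp (-(a * t)) : ℂ) ∧
      ∀ x : ℝ, 0 ≤ x →
        (deriv (deBruijnHDiv fun u : ℝ => 1 + u ^ 2 / a ^ 2) x +
            (a : ℂ) * deBruijnHDiv (fun u : ℝ => 1 + u ^ 2 / a ^ 2) x) * (Real.exp (-(a * x)) : ℂ) =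
          (a : ℂ) ^ 2 * ∫ t in Ioi x, deBruijnH 0 t * (Real.exp (-(a * t)) : ℂ) := by
  set F : ℂ → ℂ := deBruijnHDiv fun u : ℝ => 1 + u ^ 2 / a ^ 2 with hFdef
  have ha0 : a ≠ 0 := ha.ne'
  have haC : (a : ℂ) ≠ 0 := by exact_mod_cast ha0
  -- `H_0` is bounded on `ℝ` (decay exponent `b = 0`), so `H_0 e^{−at}` is integrable on `(0, ∞)`
  obtain ⟨C, -, hC⟩ := UniversalFactor.exists_norm_deBruijnH_zero_le (b := 0) le_rfl (by positivity)
  obtain ⟨hintm, -⟩ := UniversalFactor.integrableOn_deBruijnH_zero_mul_exp (c := a) (b := 0) (C := C)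
    (by linarith) hC
  set Jm : ℂ := ∫ t in Ioi (0 : ℝ), deBruijnH 0 t * (Real.exp (-(a * t)) : ℂ) with hJm
  set gm : ℝ → ℂ := fun y ↦ deriv F y + (a : ℂ) * F y with hgm
  have hGm : ∀ x : ℝ, gm x * (Real.exp (-(a * x)) : ℂ) =
      gm 0 - (a : ℂ) ^ 2 * ∫ t in (0 : ℝ)..x, deBruijnH 0 t * (Real.exp (-(a * t)) : ℂ) :=
    fun x ↦ UniversalFactor.laplaceG_eq (c := a) ha0 rfl x
  have hIm : Tendsto (fun x : ℝ ↦ ∫ t in (0 : ℝ)..x, deBruijnH 0 t * (Real.exp (-(a * t)) : ℂ))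
      atTop (𝓝 Jm) := intervalIntegral_tendsto_integral_Ioi 0 hintm tendsto_id
  have hGlim : Tendsto (fun x : ℝ ↦ gm x * (Real.exp (-(a * x)) : ℂ)) atTop
      (𝓝 (gm 0 - (a : ℂ) ^ 2 * Jm)) := by
    have h := (hIm.const_mul ((a : ℂ) ^ 2)).const_sub (gm 0)
    exact h.congr' (Eventually.of_forall fun x ↦ (hGm x).symm)
  obtain ⟨B, hB⟩ := UniversalFactor.exists_bound_deBruijnHDiv_laplace a
  have hgbd : ∀ x : ℝ, ‖gm x‖ ≤ B + |a| * B := fun x ↦ by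
    calc ‖gm x‖ ≤ ‖deriv F x‖ + ‖(a : ℂ) * F x‖ := norm_add_le _ _
      _ ≤ B + |a| * B := by
          rw [norm_mul, Complex.norm_real, Real.norm_eq_abs]
          exact add_le_add (hB x).2 (mul_le_mul_of_nonneg_left (hB x).1 (abs_nonneg a))
  have hL : gm 0 - (a : ℂ) ^ 2 * Jm = 0 := by
    by_contra hL
    have hnorm : Tendsto (fun x : ℝ ↦ ‖gm x * (Real.exp (-(a * x)) : ℂ)‖ * Real.exp (a * x)) atTop atTop :=
      (hGlim.norm).pos_mul_atTop (norm_pos_iff.2 hL)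
        (Real.tendsto_exp_atTop.comp (tendsto_id.const_mul_atTop ha))
    obtain ⟨x, hx⟩ := (tendsto_atTop.1 hnorm (B + |a| * B + 1)).exists
    have heq : ‖gm x * (Real.exp (-(a * x)) : ℂ)‖ * Real.exp (a * x) = ‖gm x‖ := by
      rw [norm_mul, Complex.norm_real, Real.norm_eq_abs, abs_of_pos (Real.exp_pos _), mul_assoc,
        ← Real.exp_add, neg_add_cancel, Real.exp_zero, mul_one]
    rw [heq] at hx
    linarith [hgbd x]
  have hderiv0 : deriv F (0 : ℝ) = 0 := by
    rw [(isDivAdmissible_laplace a).deriv_deBruijnHDiv]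
    simp [divSinMoment, divSinIntegrand]
  have hg0 : gm 0 = (a : ℂ) * F (0 : ℝ) := by simp only [hgm, hderiv0, zero_add]
  refine ⟨by rw [← hg0]; exact sub_eq_zero.1 hL, fun x hx ↦ ?_⟩
  show gm x * (Real.exp (-(a * x)) : ℂ) = (a : ℂ) ^ 2 * ∫ t in Ioi x, deBruijnH 0 t * (Real.exp (-(a * t)) : ℂ)
  rw [hGm x, ← intervalIntegral.integral_Ioi_sub_Ioi hintm hx, ← hJm, mul_sub, sub_eq_zero.1 hL]
  ring

/-! ## The exceptional wide directions: `F_a` decays like `H_0` -/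

/-- **Decay of `F_a` in the exceptional wide directions** (analytic half of the route's item
`ExceptionalWideNoGo`, stmt-RiemannHypothesis-2583: "`F_a(x) = −a∫₀^∞ H_0(x+v) sinh(av) dv` decays
like `e^{−πx/8}`"). If `0 < a < b < π/8` and the residue integral vanishes,
`∫₀^∞ H_0(x) cosh(ax) dx = 0`, then `‖F_a(x)‖ ≤ K e^{−bx}` for all `x ≥ 0`. Proof: by
`laplaceG_pos_eq`, `e^{ax}(F' + aF) = a² e^{2ax} ∫ₓ^∞ H_0 e^{−at} = O(e^{(a−b)x})`; by `laplaceG_eq`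
with `c = −a` and the vanishing residue, `e^{ax}(F' − aF) = a² ∫ₓ^∞ H_0 e^{at} = O(e^{(a−b)x})`; and
`2a e^{ax} F = e^{ax}(F' + aF) − e^{ax}(F' − aF)`. (When the residue is `≠ 0` the same identities
give the tree's `wideKernelTail`, `e^{ax}F_a(x) → a∫₀^∞ H_0 cosh(a·)`.) [folklore] -/
theorem UniversalFactor.norm_deBruijnHDiv_laplace_le_of_integral_cosh_eq_zero {a b : ℝ} (ha : 0 < a)
    (hab : a < b) (hb : b < Real.pi / 8)
    (h0 : (∫ x in Ioi (0 : ℝ), deBruijnH 0 (x : ℂ) * (Real.cosh (a * x) : ℂ)) = 0) :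
    ∃ K : ℝ, ∀ x : ℝ, 0 ≤ x →
      ‖deBruijnHDiv (fun u : ℝ => 1 + u ^ 2 / a ^ 2) x‖ ≤ K * Real.exp (-(b * x)) := by
  set F : ℂ → ℂ := deBruijnHDiv fun u : ℝ => 1 + u ^ 2 / a ^ 2 with hFdef
  have ha0 : a ≠ 0 := ha.ne'
  have haC : (a : ℂ) ≠ 0 := by exact_mod_cast ha0
  obtain ⟨C, hC0, hC⟩ := UniversalFactor.exists_norm_deBruijnH_zero_le (b := b) (by linarith) hb
  obtain ⟨hintm, hbdm⟩ := UniversalFactor.integrableOn_deBruijnH_zero_mul_exp (c := a) (b := b) (C := C)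
    (by linarith) hC
  obtain ⟨hintp, hbdp⟩ := UniversalFactor.integrableOn_deBruijnH_zero_mul_exp (c := -a) (b := b) (C := C)
    (by linarith) hC
  set Jm : ℂ := ∫ t in Ioi (0 : ℝ), deBruijnH 0 t * (Real.exp (-(a * t)) : ℂ) with hJm
  set Jp : ℂ := ∫ t in Ioi (0 : ℝ), deBruijnH 0 t * (Real.exp (-(-a * t)) : ℂ) with hJp
  obtain ⟨hF0, hGtail⟩ := UniversalFactor.laplaceG_pos_eq ha
  -- the `c = −a` identity and the vanishing residue
  set gp : ℝ → ℂ := fun y ↦ deriv F y + ((-a : ℝ) : ℂ) * F y with hgp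
  have hsq : (-a) ^ 2 = a ^ 2 := by ring
  have hGp : ∀ x : ℝ, gp x * (Real.exp (-(-a * x)) : ℂ) =
      gp 0 - (a : ℂ) ^ 2 * ∫ t in (0 : ℝ)..x, deBruijnH 0 t * (Real.exp (-(-a * t)) : ℂ) :=
    fun x ↦ UniversalFactor.laplaceG_eq (c := -a) ha0 hsq x
  have hderiv0 : deriv F (0 : ℝ) = 0 := by
    rw [(isDivAdmissible_laplace a).deriv_deBruijnHDiv]
    simp [divSinMoment, divSinIntegrand]
  have hgp0 : gp 0 = -(a : ℂ) * F (0 : ℝ) := by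
    simp only [hgp, hderiv0, zero_add]; push_cast; ring
  have hcosh : (∫ y in Ioi (0 : ℝ), deBruijnH 0 (y : ℂ) * (Real.cosh (a * y) : ℂ)) = (Jp + Jm) / 2 := by
    rw [hJp, hJm, ← integral_add hintp hintm, ← integral_div]
    refine setIntegral_congr_fun measurableSet_Ioi fun y _ ↦ ?_
    rw [Real.cosh_eq]
    push_cast
    ring_nf
  have hJ : Jp = -Jm := by
    rw [hcosh] at h0
    linear_combination 2 * h0
  have hconst : gp 0 - (a : ℂ) ^ 2 * Jp = 0 := by
    rw [hgp0, hJ]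
    linear_combination -hF0
  have hGptail : ∀ x : ℝ, 0 ≤ x → gp x * (Real.exp (a * x) : ℂ) =
      (a : ℂ) ^ 2 * ∫ t in Ioi x, deBruijnH 0 t * (Real.exp (-(-a * t)) : ℂ) := by
    intro x hx
    have h := hGp x
    have he : (Real.exp (-(-a * x)) : ℝ) = Real.exp (a * x) := by congr 1; ring
    rw [he, ← intervalIntegral.integral_Ioi_sub_Ioi hintp hx, ← hJp, mul_sub] at h
    rw [h]
    linear_combination hconst
  -- tail bounds
  have htail_m : ∀ x : ℝ, 0 ≤ x →
      ‖∫ t in Ioi x, deBruijnH 0 t * (Real.exp (-(a * t)) : ℂ)‖ ≤ C / (b + a) * Real.exp (-(b + a) * x) := by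
    intro x hx
    have hba : -(b + a) < 0 := by linarith
    calc ‖∫ t in Ioi x, deBruijnH 0 t * (Real.exp (-(a * t)) : ℂ)‖
        ≤ ∫ t in Ioi x, C * Real.exp (-(b + a) * t) :=
          norm_integral_le_of_norm_le ((integrableOn_exp_mul_Ioi hba x).const_mul C)
            (ae_restrict_of_forall_mem measurableSet_Ioi fun t ht ↦ hbdm t (lt_of_le_of_lt hx ht))
      _ = C * (-Real.exp (-(b + a) * x) / (-(b + a))) := by
          rw [integral_const_mul, integral_exp_mul_Ioi hba x]
      _ = C / (b + a) * Real.exp (-(b + a) * x) := by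
          have : b + a ≠ 0 := by linarith
          field_simp
  have htail_p : ∀ x : ℝ, 0 ≤ x →
      ‖∫ t in Ioi x, deBruijnH 0 t * (Real.exp (-(-a * t)) : ℂ)‖ ≤ C / (b - a) * Real.exp (-(b - a) * x) := by
    intro x hx
    have hba : -(b + -a) < 0 := by linarith
    calc ‖∫ t in Ioi x, deBruijnH 0 t * (Real.exp (-(-a * t)) : ℂ)‖
        ≤ ∫ t in Ioi x, C * Real.exp (-(b + -a) * t) :=
          norm_integral_le_of_norm_le ((integrableOn_exp_mul_Ioi hba x).const_mul C)
            (ae_restrict_of_forall_mem measurableSet_Ioi fun t ht ↦ hbdp t (lt_of_le_of_lt hx ht))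
      _ = C * (-Real.exp (-(b + -a) * x) / (-(b + -a))) := by
          rw [integral_const_mul, integral_exp_mul_Ioi hba x]
      _ = C / (b - a) * Real.exp (-(b - a) * x) := by
          have : b - a ≠ 0 := by linarith
          have : b + -a ≠ 0 := by linarith
          field_simp
          ring_nf
  -- assemble
  refine ⟨a / 2 * (C / (b + a) + C / (b - a)), fun x hx ↦ ?_⟩
  have hsplit : F x = ((Real.exp (a * x) : ℂ) * ((deriv F x + (a : ℂ) * F x) * (Real.exp (-(a * x)) : ℂ))
      - (Real.exp (-(a * x)) : ℂ) * (gp x * (Real.exp (a * x) : ℂ))) / (2 * a) := by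
    have h1 : (Real.exp (a * x) : ℝ) * Real.exp (-(a * x)) = 1 := by
      rw [← Real.exp_add, add_neg_cancel, Real.exp_zero]
    have h1' : (Real.exp (a * x) : ℂ) * (Real.exp (-(a * x)) : ℂ) = 1 := by exact_mod_cast h1
    have h2a0 : (2 * (a : ℂ)) ≠ 0 := mul_ne_zero two_ne_zero haC
    rw [eq_div_iff h2a0]
    simp only [hgp]
    rw [Complex.ofReal_neg]
    linear_combination (-(2 * (a : ℂ) * F x)) * h1'
  rw [hsplit, hGtail x hx, hGptail x hx, norm_div]
  have h2a : ‖(2 : ℂ) * a‖ = 2 * a := by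
    rw [norm_mul, Complex.norm_ofNat, Complex.norm_real, Real.norm_eq_abs, abs_of_pos ha]
  rw [h2a, div_le_iff₀ (by positivity)]
  have hea : 0 < Real.exp (a * x) := Real.exp_pos _
  have hena : 0 < Real.exp (-(a * x)) := Real.exp_pos _
  calc ‖(Real.exp (a * x) : ℂ) * ((a : ℂ) ^ 2 * ∫ t in Ioi x, deBruijnH 0 t * (Real.exp (-(a * t)) : ℂ)) -
        (Real.exp (-(a * x)) : ℂ) * ((a : ℂ) ^ 2 * ∫ t in Ioi x, deBruijnH 0 t * (Real.exp (-(-a * t)) : ℂ))‖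
      ≤ ‖(Real.exp (a * x) : ℂ) * ((a : ℂ) ^ 2 * ∫ t in Ioi x, deBruijnH 0 t * (Real.exp (-(a * t)) : ℂ))‖ +
        ‖(Real.exp (-(a * x)) : ℂ) * ((a : ℂ) ^ 2 * ∫ t in Ioi x, deBruijnH 0 t * (Real.exp (-(-a * t)) : ℂ))‖ :=
        norm_sub_le _ _
    _ ≤ Real.exp (a * x) * (a ^ 2 * (C / (b + a) * Real.exp (-(b + a) * x))) +
        Real.exp (-(a * x)) * (a ^ 2 * (C / (b - a) * Real.exp (-(b - a) * x))) := by
        rw [norm_mul, norm_mul, norm_mul, norm_mul, Complex.norm_real, Complex.norm_real,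
          Real.norm_eq_abs, Real.norm_eq_abs, abs_of_pos hea, abs_of_pos hena, norm_pow,
          Complex.norm_real, Real.norm_eq_abs, sq_abs]
        gcongr
        · exact htail_m x hx
        · exact htail_p x hx
    _ = a / 2 * (C / (b + a) + C / (b - a)) * Real.exp (-(b * x)) * (2 * a) := by
        have e1 : Real.exp (a * x) * Real.exp (-(b + a) * x) = Real.exp (-(b * x)) := by
          rw [← Real.exp_add]; congr 1; ring
        have e2 : Real.exp (-(a * x)) * Real.exp (-(b - a) * x) = Real.exp (-(b * x)) := by
          rw [← Real.exp_add]; congr 1; ring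
        calc Real.exp (a * x) * (a ^ 2 * (C / (b + a) * Real.exp (-(b + a) * x))) +
              Real.exp (-(a * x)) * (a ^ 2 * (C / (b - a) * Real.exp (-(b - a) * x)))
            = a ^ 2 * (C / (b + a)) * (Real.exp (a * x) * Real.exp (-(b + a) * x)) +
              a ^ 2 * (C / (b - a)) * (Real.exp (-(a * x)) * Real.exp (-(b - a) * x)) := by ring
          _ = a / 2 * (C / (b + a) + C / (b - a)) * Real.exp (-(b * x)) * (2 * a) := by
              rw [e1, e2]; ring

end Summit.RiemannHypothesis.RiemannHypothesis.Theorems
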